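import Literature.MathematicalPhysics.QuantumFieldTheory.Balaban1983to89.B9Eq365QGGQLowerVariational
import Literature.MathematicalPhysics.QuantumFieldTheory.Balaban1983to89.B9Eq326OperatorSymmetric
import Literature.MathematicalPhysics.QuantumFieldTheory.Balaban1983to89.B9Eq326OperatorTower

/-!
# `Balaban1983to89.B9Eq3126QG1QLowerOfRightInverse` — T. Bałaban, *Propagators for lattice gauge theories in a background field*, Commun. Math. Phys.
# **99** (1985) 389–434 [Balaban1985BackgroundPropagators] (3.126) p. 420, (3.26) p. 395, Thm 3.11 p. 416, with [Balaban1985Variational] (45) p. 285 («`QG₁Q*` …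
# is invertible»), (110) p. 294 and [Balaban1984PropagatorsII] (2.74)–(2.77) p. 236 (the lower bound of `Q′G′Q′*` from ONE test field): **THE LETTER `μ₁` OF ROAD
# ΔA-CT's FOURTH PRIMITIVE ROW — THE SECOND GRAM OPERATOR `QG₁(U)Q†` IS BOUNDED BELOW BY `1∕M` FROM ONE RIGHT INVERSE `Ψ` OF `Q` WITH A FORM BOUND
# `re⟪Ψψ, Δ_a(U)Ψψ⟫ ≤ M‖ψ‖²`** — the first-order variational principle for `G₁ = Δ_a⁻¹` (ne9-leaf-01's `B9Eq365QGGQLowerVariational.sq_div_mul_le_re_inner_green`,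
# the device of print's (2.77)) at the test vector `u = Ψψ` against `x = Q†ψ` (`re⟪Ψψ, Q†ψ⟫ = re⟪QΨψ, ψ⟫ = ‖ψ‖²`): `(1∕M)·‖ψ‖² ≤ re⟪ψ, Q(G₁(Q†ψ))⟫` — the
# displayed hypothesis `hX1 : μ₁‖g‖² ≤ re⟪g, QG₁(U)Q†g⟫` of `B9Eq3126ConjugatedQG1QInv` ∕ `B9Eq3126QG1QInvPointDecay` ∕ `B9Eq3126H1BlockDecay` INHABITED at
# `μ₁ := 1∕M`, the letters `(Ψ, M)` remaining BINDERS (the twin, for the SECOND Gram operator, of ne9-leaf-01's `B9Eq348QGGQLowerOfRightInverse` for the third)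

statement-level skeleton of published theorems with citation tags; proofs where landed; nothing here is a claim about the Yang–Mills mass gap

CITATION HEADER (lean-in-tree rule).  Audit cell `pub-balaban`, sub-cell `t4`, BINDER row NE9 (road ΔA-CT of the NE9 formalisation swarm, leaf prover 03
`b2b-balaban-t4-ne9-formalise-leaf-03` gen 76).  Imports BY NAME (both BUILT): ne9-leaf-01's `B9Eq365QGGQLowerVariational` (§1 `sq_div_mul_le_re_inner_green`),
`B9Eq326OperatorSymmetric` (`laplaceAofU_isSymmetric`; through it `B9Eq326OperatorAssembly`), `B9Eq326OperatorTower` (`laplaceAk_isSymmetric`, `G1k`, `QkW`).  Sources READ first-hand: [Balaban1985BackgroundPropagators] p. 420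
(3.126), p. 395 (3.26), p. 416 Thm 3.11; [Balaban1985Variational] p. 285 (45), p. 294 (110); [Balaban1984PropagatorsII] p. 236 (2.74)–(2.77).  Print obtains such
lower bounds by Fourier analysis at the flat point; here ONE right inverse with a form bound suffices, at EVERY background — nothing of print's constants asserted.

WHAT IS PROVED (sorry-free; proof lane — no `def`; [folklore] Hilbert-space algebra).
* §1 `re_inner_adjoint_section_eq` (`re⟪Ψψ, Q†ψ⟫ = ‖ψ‖²` for a right inverse `Ψ`), **`re_inner_QGQadj_ge_of_section`** (abstract, `RCLike`): `T` symmetric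
  positive definite, `G = greenK T`, `Q : E →ₗ F`, ANY map `Ψ : F → E` with `Q(Ψψ) = ψ` and `re⟪Ψψ, T(Ψψ)⟫ ≤ M‖ψ‖²` (`M > 0`) ⟹ `(1∕M)‖ψ‖² ≤ re⟪ψ, Q(G(Q†ψ))⟫`.
* §2 **`re_inner_QG1ofUQadj_ge_of_rightInverse`** (one-step torus, EVERY background with unitary `U`, `*`-trace `τ`, compatible normings): for `Δ_a(U)` of
  `B9Eq326OperatorAssembly` with its displayed positivity (Thm 3.11) and ONE right inverse `Ψ` of `Q` with `re⟪Ψψ, Δ_a(U)(Ψψ)⟫ ≤ M‖ψ‖²`: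
  `(1∕M)·‖g‖² ≤ re⟪g, Q(G₁(U)(Q†g))⟫` — `hX1` VERBATIM at `μ₁ := 1∕M`.
* §3 **`re_inner_QkG1kQadj_ge_of_rightInverse`** (tower `towerP L m (n+1)`, every height `n`): the same at `Δ_{a,k}(U) = B9Eq326OperatorTower.laplaceAk`,
  `G₁,k = G1k`, `Q_k(U) = QkW` — the `hX1` of `B9Eq3126ConjugatedQG1QInvTower` ∕ `B9Eq3126QG1QInvPointDecayTower` ∕ `B9Eq3126H1BlockDecayTower` at `μ₁ := 1∕M`.
HONEST SCOPE.  The letters `Ψ` and `M` are BINDERS (print: `Ψ = ` the block-constant extension, `M = O(1)` by (3.30)-type bounds — NOT asserted); no window, no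
volume, no number; NOT NE9 (cell pub-balaban: NE9 NOT PRINTED ∕ NOT PROVED; «NE9 ⇐ the named binders»; row WALLED ON A MODEL (O-NE9-1; #5 UNRULED); spine PROVED
0∕9; rung (B)+1 on a finite T⁴ — NOT infinite volume, NOT mass gap, NOT BetaPertH, NOT Clay; HONEST DEPENDENCY: continuum YM on T⁴ ⇐ BetaPertH ∧ nine spine estimates
(0/9 proved); BetaPertH ⇐ (D1) ∧ (D4) ∧ CAP+tail).  NEW file; nothing modified.  Net new unproved facts: 0.
-/

noncomputable section

open scoped InnerProductSpace ComplexConjugate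

namespace Literature.MathematicalPhysics.QuantumFieldTheory.Balaban1983to89.B9Eq3126QG1QLowerOfRightInverse

open B4Sect5Torus (TSite)
open B9SectCLatticeCarrier (Bond)
open B9Eq319QprimeTorus (fineP)
open B11Eq103H1Complex (BondL2K greenK)
open B9Eq310HessianOperator (adTransportW)
open B9Eq326OperatorAssembly (laplaceAofU G1ofU)
open B9Eq326OperatorSymmetric (laplaceAofU_isSymmetric)
open B9Eq315QTower (towerP)
open B9Eq315QTorus (perCfg cornerSite)
open B7Prop1Explicit (Wcx boxVec U1)
open B9Eq326OperatorTower (laplaceAk G1k QkW laplaceAk_isSymmetric)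
open B9Eq365QGGQLowerVariational (sq_div_mul_le_re_inner_green)

/-! ## §1 The second Gram operator bounded below from one right inverse (abstract, `RCLike`) -/

section Abstract

variable {𝕜 : Type*} [RCLike 𝕜] {E : Type*} [NormedAddCommGroup E] [InnerProductSpace 𝕜 E] [FiniteDimensional 𝕜 E]
  {F : Type*} [NormedAddCommGroup F] [InnerProductSpace 𝕜 F] [FiniteDimensional 𝕜 F]
  {T : E →ₗ[𝕜] E} (hTs : T.IsSymmetric) (hpos : ∀ x : E, x ≠ 0 → 0 < RCLike.re ⟪x, T x⟫_𝕜)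

/-- a right inverse `Ψ` of `Q` pairs with `Q†ψ` to the norm: `re⟪Ψψ, Q†ψ⟫ = ‖ψ‖²`. [folklore] [cite: Balaban1985Variational, (45) p.285] -/
theorem re_inner_adjoint_section_eq (Q : E →ₗ[𝕜] F) (Ψ : F → E) (hΨ : ∀ ψ, Q (Ψ ψ) = ψ) (ψ : F) :
    RCLike.re ⟪Ψ ψ, LinearMap.adjoint Q ψ⟫_𝕜 = ‖ψ‖ ^ 2 := by
  rw [LinearMap.adjoint_inner_right, hΨ, inner_self_eq_norm_sq (𝕜 := 𝕜)]

include hTs in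
/-- **`QGQ† ≥ 1∕M` FROM ONE RIGHT INVERSE**: `T` symmetric positive definite with Green operator `G = T⁻¹`, `Q : E →ₗ F`, ANY `Ψ : F → E` with `Q(Ψψ) = ψ` and
`re⟪Ψψ, T(Ψψ)⟫ ≤ M‖ψ‖²` (`M > 0`) ⟹ `(1∕M)‖ψ‖² ≤ re⟪ψ, Q(G(Q†ψ))⟫` — the variational principle `2re⟪u, x⟫ − re⟪u, Tu⟫ ≤ re⟪x, Gx⟫` at `x = Q†ψ`, `u = (1∕M)Ψψ`.
[folklore] [cite: Balaban1984PropagatorsII, (2.74)–(2.77) p.236; Balaban1985Variational, (45) p.285; Balaban1985BackgroundPropagators, (3.126) p.420] -/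
theorem re_inner_QGQadj_ge_of_section (Q : E →ₗ[𝕜] F) (Ψ : F → E) {M : ℝ} (hM : 0 < M) (hΨ : ∀ ψ, Q (Ψ ψ) = ψ)
    (hΨM : ∀ ψ, RCLike.re ⟪Ψ ψ, T (Ψ ψ)⟫_𝕜 ≤ M * ‖ψ‖ ^ 2) (ψ : F) :
    1 / M * ‖ψ‖ ^ 2 ≤ RCLike.re ⟪ψ, Q (greenK T hpos (LinearMap.adjoint Q ψ))⟫_𝕜 := by
  have hux : (1 : ℝ) * ‖ψ‖ ^ 2 ≤ RCLike.re ⟪Ψ ψ, LinearMap.adjoint Q ψ⟫_𝕜 := by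
    rw [re_inner_adjoint_section_eq Q Ψ hΨ ψ, one_mul]
  have h := sq_div_mul_le_re_inner_green hTs hpos (x := LinearMap.adjoint Q ψ) (u := Ψ ψ) (β := 1) (M := M) (P := ‖ψ‖ ^ 2) hM zero_le_one hux (hΨM ψ)
  rw [one_pow, LinearMap.adjoint_inner_left] at h
  exact h

end Abstract

/-! ## §2 The lattice reading: `μ₁ := 1∕M` for `QG₁(U)Q†` at the assembled `Δ_a(U)` -/

section Lattice

variable {d : ℕ} (L : ℕ) [NeZero L] (m : Fin d → ℕ) {𝔸 : Type*} [Ring 𝔸] [StarRing 𝔸] [Algebra ℂ 𝔸] [StarModule ℂ 𝔸]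
  {W : Type*} [NormedAddCommGroup W] [InnerProductSpace ℂ W] [FiniteDimensional ℂ W] (φ : W ≃ₗ[ℂ] 𝔸) {c₀ : ℝ} [Fact (0 < c₀)]
  (τ : 𝔸 →ₗ[ℂ] ℂ) (η : ℝ) {U : Bond d (fineP L m) → 𝔸ˣ} {F : Type*} [NormedAddCommGroup F] [InnerProductSpace ℂ F] [FiniteDimensional ℂ F]

/-- **THE LETTER `μ₁` OF THE FOURTH PRIMITIVE ROW, FROM ONE RIGHT INVERSE OF `Q`**: on the one-step torus, for a unitary background (`U(b)* = U(b)⁻¹`), a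
`*`-trace `τ` and compatible normings (so `Δ_a(U)` is symmetric — `B9Eq326OperatorSymmetric`), the displayed positivity `hpos` of `Δ_a(U)` (Thm 3.11), and ONE map
`Ψ` with `Q(Ψg) = g` and `re⟪Ψg, Δ_a(U)(Ψg)⟫ ≤ M‖g‖²` (`M > 0`): `(1∕M)·‖g‖² ≤ re⟪g, Q(G₁(U)(Q†g))⟫` for every `g` — the hypothesis `hX1` of
`B9Eq3126ConjugatedQG1QInv.norm_conjKinv_le` ∕ `B9Eq3126QG1QInvPointDecay.norm_bondPoint_Kinv_le` ∕ `B9Eq3126H1BlockDecay.norm_block_H1ofU_le` at `μ₁ := 1∕M`.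
[cite: Balaban1985BackgroundPropagators, (3.126) p.420, (3.26) p.395, Thm 3.11 p.416; Balaban1985Variational, (45) p.285, (110) p.294; Balaban1984PropagatorsII, (2.77) p.236] -/
theorem re_inner_QG1ofUQadj_ge_of_rightInverse (hU : ∀ b, star (U b : 𝔸) = ((U b)⁻¹ : 𝔸ˣ)) (hτ₁ : ∀ X : 𝔸, τ (star X) = conj (τ X))
    (hτ₂ : ∀ X Y : 𝔸, τ (X * Y) = τ (Y * X)) (hφ : ∀ X Y : 𝔸, ⟪φ.symm X, φ.symm Y⟫_ℂ = τ (star X * Y))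
    (Q : BondL2K ℂ d (fineP L m) c₀ W →ₗ[ℂ] F) (a : ℝ)
    (hpos : ∀ x : BondL2K ℂ d (fineP L m) c₀ W, x ≠ 0 → 0 < RCLike.re ⟪x, laplaceAofU L m φ η U τ Q a x⟫_ℂ)
    (Ψ : F → BondL2K ℂ d (fineP L m) c₀ W) {M : ℝ} (hM : 0 < M) (hΨ : ∀ g, Q (Ψ g) = g)
    (hΨM : ∀ g, RCLike.re ⟪Ψ g, laplaceAofU L m φ η U τ Q a (Ψ g)⟫_ℂ ≤ M * ‖g‖ ^ 2) (g : F) :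
    1 / M * ‖g‖ ^ 2 ≤ RCLike.re ⟪g, Q (G1ofU L m φ η U τ hpos (LinearMap.adjoint Q g))⟫_ℂ :=
  re_inner_QGQadj_ge_of_section (laplaceAofU_isSymmetric L m φ τ η hU hτ₁ hτ₂ hφ Q a) hpos Q Ψ hM hΨ hΨM g

end Lattice

/-! ## §3 The tower reading: `μ₁ := 1∕M` for `Q_kG₁,k(U)Q_k†` at every height -/

section Tower

variable {d : ℕ} (L : ℕ) [NeZero L] (m : Fin d → ℕ) [∀ i, NeZero (m i)] (n : ℕ) {𝔸 : Type*} [NormedRing 𝔸] [StarRing 𝔸] [NormedAlgebra ℂ 𝔸]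
  [StarModule ℂ 𝔸] [CompleteSpace 𝔸] [NormOneClass 𝔸]
  {W : Type*} [NormedAddCommGroup W] [InnerProductSpace ℂ W] [FiniteDimensional ℂ W] (φ : W ≃ₗ[ℂ] 𝔸) {c₀ c₁ : ℝ} [Fact (0 < c₀)] [Fact (0 < c₁)]
  (η : ℝ) (U : Bond d (towerP L m (n + 1)) → 𝔸ˣ) (hL : 1 ≤ L) (α : ℕ → ℝ) (hα1 : ∀ j, α j ≤ 1 / 64)
  (hU1 : ∀ (j : ℕ) (x : B7Prop1Explicit.Site d) (κ : Fin d), perCfg (towerP L m (j + 1)) (B9Eq315QTower.UlevOf L m (n + 1) U j) x κ ∈ U1 𝔸)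
  (hreg : ∀ (j : ℕ) (y : TSite d (towerP L m j)) (κ : Fin d) (r : Fin d → Fin L),
    ‖((Wcx L (perCfg (towerP L m (j + 1)) (B9Eq315QTower.UlevOf L m (n + 1) U j)) (cornerSite L y) κ (boxVec L r) : 𝔸ˣ) : 𝔸) - 1‖ ≤ α j)
  (τ : 𝔸 →ₗ[ℂ] ℂ)

/-- **THE LETTER `μ₁` AT `n+1` LEVELS, FROM ONE RIGHT INVERSE OF `Q_k(U)`**: for a unitary background on `towerP L m (n+1)`, a `*`-trace and compatible normings
(`B9Eq326OperatorTower.laplaceAk_isSymmetric`), the displayed positivity of `Δ_{a,k}(U)`, and ONE map `Ψ` with `Q_k(U)(Ψg) = g`,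
`re⟪Ψg, Δ_{a,k}(U)(Ψg)⟫ ≤ M‖g‖²` (`M > 0`): `(1∕M)·‖g‖² ≤ re⟪g, Q_k(U)(G₁,k(U)(Q_k(U)†g))⟫` for every `g`, every height `n`.
[cite: Balaban1985BackgroundPropagators, (3.126) p.420, (3.26) p.395, (3.15) p.393, Thm 3.11 p.416; Balaban1985Variational, (45) p.285; Balaban1984PropagatorsII, (2.77) p.236] -/
theorem re_inner_QkG1kQadj_ge_of_rightInverse (hU : ∀ b, star (U b : 𝔸) = ((U b)⁻¹ : 𝔸ˣ)) (hτ₁ : ∀ X : 𝔸, τ (star X) = conj (τ X))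
    (hτ₂ : ∀ X Y : 𝔸, τ (X * Y) = τ (Y * X)) (hφ : ∀ X Y : 𝔸, ⟪φ.symm X, φ.symm Y⟫_ℂ = τ (star X * Y)) (a : ℝ)
    (hpos : ∀ x : BondL2K ℂ d (towerP L m (n + 1)) c₀ W, x ≠ 0 →
      0 < RCLike.re ⟪x, laplaceAk L m n φ η U hL α hα1 hU1 hreg τ (c₀ := c₀) (c₁ := c₁) a x⟫_ℂ)
    (Ψ : BondL2K ℂ d m c₁ W → BondL2K ℂ d (towerP L m (n + 1)) c₀ W) {M : ℝ} (hM : 0 < M)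
    (hΨ : ∀ g, QkW L m n φ U hL α hα1 hU1 hreg (c₀ := c₀) (c₁ := c₁) (Ψ g) = g)
    (hΨM : ∀ g, RCLike.re ⟪Ψ g, laplaceAk L m n φ η U hL α hα1 hU1 hreg τ (c₀ := c₀) (c₁ := c₁) a (Ψ g)⟫_ℂ ≤ M * ‖g‖ ^ 2) (g : BondL2K ℂ d m c₁ W) :
    1 / M * ‖g‖ ^ 2 ≤ RCLike.re ⟪g, QkW L m n φ U hL α hα1 hU1 hreg (c₀ := c₀) (c₁ := c₁)
      (G1k L m n φ η U hL α hα1 hU1 hreg τ (c₀ := c₀) (c₁ := c₁) hpos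
        (LinearMap.adjoint (QkW L m n φ U hL α hα1 hU1 hreg (c₀ := c₀) (c₁ := c₁)) g))⟫_ℂ :=
  re_inner_QGQadj_ge_of_section (laplaceAk_isSymmetric L m n φ η U hL α hα1 hU1 hreg τ hU hτ₁ hτ₂ hφ a) hpos _ Ψ hM hΨ hΨM g

end Tower

end Literature.MathematicalPhysics.QuantumFieldTheory.Balaban1983to89.B9Eq3126QG1QLowerOfRightInverse

end
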